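import Literature.Analysis.FunctionSpaces.SchauderConstantLaplacian
import HarnessLib

/-!
# The constant-coefficient Schauder estimate for `Δ` on `ℝⁿ`: real-valued functions (Schauder program, B0)

Topic `Literature/Analysis/FunctionSpaces`. The Littlewood–Paley proof of the constant-
coefficient Schauder estimate (`exists_schauder_const_laplacian_direction`,
`SchauderConstantLaplacian.lean`; Gilbarg–Trudinger 2001, Thm. 4.8) lives over complex Banach
spaces of values (tempered distributions are `ℂ`-linear). This file transfers it to real-valued
functions through the isometric embedding `ℝ → ℂ`, which commutes with all derivatives and with
the Laplacian: for `0 < α < 1` and `a, b ∈ E` there is `C < ∞` with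

  `‖D²u(x)(a,b) − D²u(y)(a,b)‖ ≤ C (‖u‖_∞ + [Δu]_α) ‖x − y‖^α`

for every real `u ∈ C²_b(E)` with `α`-Hölder Laplacian.

* `exists_schauder_const_laplacian_direction_real`.

Census item (2a) of `Literature.Geometry.Riemannian.gurskyViaclovsky_pathOpen_weighted_four`.
Everything is proved; no named facts.

## References

* D. Gilbarg, N. S. Trudinger, *Elliptic Partial Differential Equations of Second Order* (2001),
  Thm. 4.8. [GilbargTrudinger2001]
-/

noncomputable section

open MeasureTheory Filter Topology Function
open scoped ENNReal NNReal ContDiff Laplacian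

namespace Literature.Analysis.FunctionSpaces

variable {E : Type*} [NormedAddCommGroup E] [InnerProductSpace ℝ E] [FiniteDimensional ℝ E]
  [MeasurableSpace E] [BorelSpace E]

/-- **The constant-coefficient Schauder estimate for `Δ` on `ℝⁿ`, real-valued directional form.**
For `0 < α < 1` and `a, b ∈ E` there is `C < ∞` such that for every real `u ∈ C²_b(E)`
(bounded with bounded first and second derivatives) whose Laplacian is `α`-Hölder with constant
`CΔ`, `edist (D²u(x)(a,b)) (D²u(y)(a,b)) ≤ C (‖u‖_∞ + CΔ) edist(x,y)^α`.
[cite: GilbargTrudinger2001, Thm. 4.8] -/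
theorem exists_schauder_const_laplacian_direction_real {α : ℝ≥0} (hα0 : 0 < α) (hα1 : α < 1)
    (a b : E) :
    ∃ C : ℝ≥0∞, C < ⊤ ∧ ∀ (u : E → ℝ) (M₀ M₁ M₂ : ℝ) (CΔ : ℝ≥0),
      ContDiff ℝ 2 u → (∀ x, ‖u x‖ ≤ M₀) → (∀ x, ‖fderiv ℝ u x‖ ≤ M₁) →
      (∀ x, ‖iteratedFDeriv ℝ 2 u x‖ ≤ M₂) → HolderWith CΔ α (Δ u) →
      ∀ x y, edist (iteratedFDeriv ℝ 2 u x ![a, b]) (iteratedFDeriv ℝ 2 u y ![a, b]) ≤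
        C * (ENNReal.ofReal M₀ + CΔ) * edist x y ^ (α : ℝ) := by
  obtain ⟨C, hCtop, hC⟩ := exists_schauder_const_laplacian_direction (E := E) (F := ℂ) hα0 hα1 a b
  refine ⟨C, hCtop, fun u M₀ M₁ M₂ CΔ hu hM₀ hM₁ hM₂ hΔ x y => ?_⟩
  -- the complexified function
  set v : E → ℂ := fun x => (u x : ℂ) with hv
  have hvdef : v = Complex.ofRealCLM ∘ u := rfl
  have hvc : ContDiff ℝ 2 v := by rw [hvdef]; exact Complex.ofRealCLM.contDiff.comp hu
  have hvLI : v = Complex.ofRealLI ∘ u := rfl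
  -- bounds transfer (the embedding is an isometry)
  have hv0 : ∀ x, ‖v x‖ ≤ M₀ := fun x => by
    rw [hv]
    simp only [Complex.norm_real]
    exact hM₀ x
  have hnormD : ∀ (i : ℕ) (hi : i ≤ 2) (x : E), ‖iteratedFDeriv ℝ i v x‖ = ‖iteratedFDeriv ℝ i u x‖ :=
    fun i hi x => by
      rw [hvLI]
      exact Complex.ofRealLI.norm_iteratedFDeriv_comp_left hu.contDiffAt (by exact_mod_cast hi)
  have hv1 : ∀ x, ‖fderiv ℝ v x‖ ≤ M₁ := fun x => by
    have h1 : ‖fderiv ℝ v x‖ = ‖iteratedFDeriv ℝ 1 v x‖ := by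
      rw [← norm_iteratedFDeriv_fderiv (n := 0), norm_iteratedFDeriv_zero]
    have h2 : ‖fderiv ℝ u x‖ = ‖iteratedFDeriv ℝ 1 u x‖ := by
      rw [← norm_iteratedFDeriv_fderiv (n := 0), norm_iteratedFDeriv_zero]
    rw [h1, hnormD 1 (by norm_num) x, ← h2]
    exact hM₁ x
  have hv2 : ∀ x, ‖iteratedFDeriv ℝ 2 v x‖ ≤ M₂ := fun x => by
    rw [hnormD 2 le_rfl x]
    exact hM₂ x
  -- the Laplacian commutes with the embedding
  have hΔv : Δ v = fun x => ((Δ u) x : ℂ) := by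
    funext x
    rw [hvdef, (hu.contDiffAt (x := x)).laplacian_CLM_comp_left]
    rfl
  have hΔH : HolderWith CΔ α (Δ v) := by
    rw [hΔv]
    intro x y
    rw [Complex.isometry_ofReal.edist_eq]
    exact hΔ x y
  -- second derivatives commute with the embedding
  have hD2 : ∀ x, iteratedFDeriv ℝ 2 v x ![a, b] = ((iteratedFDeriv ℝ 2 u x ![a, b] : ℝ) : ℂ) := by
    intro x
    rw [hvdef, Complex.ofRealCLM.iteratedFDeriv_comp_left hu.contDiffAt le_rfl]
    rfl
  have h := hC v M₀ M₁ M₂ CΔ hvc hv0 hv1 hv2 hΔH x y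
  rwa [hD2, hD2, Complex.isometry_ofReal.edist_eq] at h

end Literature.Analysis.FunctionSpaces

end
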